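import Summits.Langlands.Langlands.Theorems.IrreducibilityBySelfDualityHeckeEigenvalueFieldStubModuleFiniteGoodCover
import Summits.Langlands.Langlands.Theorems.IrreducibilityBySelfDualityHeckeEigenvalueFieldStubConeModel
import Summits.Langlands.Langlands.Theorems.IrreducibilityBySelfDualityHeckeEigenvalueFieldStubArchFundamentalSet
import Summits.Langlands.Langlands.Theorems.IrreducibilityBySelfDualityHeckeEigenvalueFieldStubArchSiegelProperty
import Summits.Langlands.Langlands.Theorems.IrreducibilityBySelfDualityHeckeEigenvalueFieldStubAssemblyLemmas
import Literature.NumberTheory.Automorphic.SiegelTranslateCover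
import Literature.NumberTheory.Automorphic.SiegelReducedFamilies
import Literature.NumberTheory.Automorphic.CompletedCohomologyHeckeAlgebraGLn
import Literature.Algebra.Homology.GroupCohomologyEquivariantGoodCover
import HarnessLib

/-!
# Borel–Serre finite-dimensionality for congruence subgroups of `GL_n` — the assembly
# (stub `stub_borelSerre_assembly` of line `Sketch`)

Crux `HeckeEigenvalueField` (stmt-Langlands-13632).  For a number field `K`, a compact open
`U ≤ GL_n(𝔸_K^∞)`, the congruence subgroup `Γ_U = GL_n(K) ∩ U` and a finite-dimensional
representation `A` of `Γ_U` over a field `k`, every `H^q(Γ_U, A)` is finite-dimensional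
([BorelSerre1973, §11.1, Thm. 11.4.4]).  This file proves the registered stub
`stub_borelSerre_assembly`: the theorem GIVEN the Hull Lemma (`hHull`), the relative openness
(`hOpen`) and positivity (`hPos`) of Siegel-reduced families, and the two halves of the sandwich of
the archimedean Siegel domain between reduced families (`hIn`, `hOut`), from the four landed stubs
`stub_moduleFinite_goodCover` (Brown's criterion in Čech form), `stub_coneModel` (the cone of
positive forms over `K ⊗ ℝ`), `stub_archFundamentalSet` and `stub_archSiegelProperty` (reduction
theory in archimedean form).  It is the all-`(n, K)` version of the landed Bianchi proof
`BianchiCongruenceCohomologyFinite_proof`.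

Proof.  `Γ_U` acts through `θ = GL_n(mixedEmbedding K)` on the contractible cone
`X ⊆ M_n(K ⊗ ℝ)` of matrices positive definite at every place, by `g • H = g H gᴴ`
(`stub_coneModel`: transitive, stabiliser of `1` equal to `K_∞`, convex).  The prototype open set is
the CONVEX HULL `V = conv R₀` of the set `R₀` of matrices with `(c, C, τ)`-reduced family of places,
the constants being those of sandwich-in for Borel's fundamental set (`stub_archFundamentalSet`):
`V` lies in the cone (`hPos`), in the `(c', C', τ')`-reduced matrices (`hHull`), hence in the image
`𝔖' • 1` of a second archimedean Siegel set (`hOut`), and it is relatively open in the self-adjoint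
matrices (`hOpen` and `assembly_convexHull_inter_relOpen`), so that its trace on the cone is open.
With the Siegel set `𝔖♯ = {h : h hᴴ ∈ V}` the fundamental-set property holds by sandwich-in and
the Siegel property by `stub_archSiegelProperty` for `𝔖'`; hence
(`SiegelCover.exists_cover_data_of_fundamentalSet_of_siegelProperty`) the translates `θ(γ) • V`,
`γ_f ∈ U Q`, form a `Γ_U`-equivariant open cover of `X` indexed by a free `Γ_U`-set with finitely
many orbits of nerve simplices, whose non-empty finite intersections are convex, hence
contractible.  Brown's criterion (`stub_moduleFinite_goodCover`) concludes.

## References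

* A. Borel, J.-P. Serre, *Corners and arithmetic groups*, Comment. Math. Helv. 48 (1973), §11.1,
  Thm. 11.4.4 [BorelSerre1973].
* K. S. Brown, *Cohomology of Groups*, GTM 87 (1982), VII (7.10), VIII §2
  [Brown1982CohomologyGroups].
* A. Borel, *Introduction aux groupes arithmétiques*, Hermann (1969), §13, §15 [Borel1969].
-/

noncomputable section

set_option linter.dupNamespace false -- project-wide: `Summit.Langlands.Langlands` is the mandated namespace

open scoped Classical Pointwise ComplexOrder Matrix
open Filter NumberField NumberField.mixedEmbedding IsDedekindDomain CategoryTheory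
open Literature.NumberTheory.Automorphic Literature.Algebra.Homology
open Literature.AlgebraicTopology.SingularHomology

namespace Summit.Langlands.Langlands.Theorems.HeckeEigenvalueField.Res

open BigHeckeGLn

/-- **Stub ASSEMBLY — Borel–Serre finite-dimensionality of `H^q(Γ_U, A)` for congruence subgroups
of `GL_n` over a number field, from the Hull Lemma, the relative openness and positivity of reduced
families, the sandwich of the archimedean Siegel domain, and the landed stubs** (Brown's criterion
in Čech form for the cover of the cone of positive forms over `K ⊗ ℝ` by the `Γ_U`-translates of the
convex hull of the reduced matrices: free index set `{γ : γ_f ∈ U Q}`, finitely many orbits of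
nerve simplices by the fundamental set and the Siegel property, contractible intersections by
convexity).
[cite: BorelSerre1973, §11.1, Thm. 11.4.4] [cite: Brown1982CohomologyGroups, VII (7.10); VIII §2]
[cite: Borel1969, §13 and §15] -/
theorem stub_borelSerre_assembly
    (hHull : ∀ (ι : Type) (m : ℕ) (c C τ : ℝ), ∃ c' C' τ' : ℝ,
      convexHull ℝ {H : ι → Matrix (Fin m) (Fin m) ℂ | SiegelFamily.IsReduced c C τ m H} ⊆
        {H | SiegelFamily.IsReduced c' C' τ' m H})
    (hOpen : ∀ (ι : Type) [Finite ι] (m : ℕ) (c C τ : ℝ), ∃ O : Set (ι → Matrix (Fin m) (Fin m) ℂ),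
      IsOpen O ∧ {H | SiegelFamily.IsReduced c C τ m H} = {H | ∀ w, (H w).IsHermitian} ∩ O)
    (hPos : (∀ (ι : Type) (m : ℕ) (c C τ : ℝ) (H : ι → Matrix (Fin m) (Fin m) ℂ),
        SiegelFamily.IsReduced c C τ m H → ∀ w, (H w).PosDef) ∧
      (∀ (n : ℕ) (K : Type) [Field K] [NumberField K] (c C τ : ℝ)
        (H : Matrix (Fin n) (Fin n) (mixedSpace K)),
        SiegelFamily.IsReduced c C τ n (SiegelFamily.placeFamily K H) →
          (∀ w, (H.map (mixedSpaceEvalReal K w)).PosDef) ∧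
            ∀ w, (H.map (mixedSpaceEvalComplex K w)).PosDef))
    (hIn : ∀ (n : ℕ) (K : Type) [Field K] [NumberField K]
      (Ω : Set (GL (Fin n) (AdeleRing (𝓞 K) K))),
      Ω ⊆ (standardParabolicGL (AdeleRing (𝓞 K) K) (id : Fin n → Fin n) :
        Set (GL (Fin n) (AdeleRing (𝓞 K) K))) →
      Ω ⊆ Set.range (GLn.ofInfinite n K) → IsCompact (closure Ω) → ∀ (t : ℝ), 0 < t →
      ∃ c C τ : ℝ, ∀ b ∈ GLn.toMixed n K ''
          (((posRealScalar n K).range : Set (GL (Fin n) (AdeleRing (𝓞 K) K))) * Ω * siegelCone n K t),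
        SiegelFamily.IsReduced c C τ n (SiegelFamily.placeFamily K
          ((b : Matrix (Fin n) (Fin n) (mixedSpace K)) * (b : Matrix (Fin n) (Fin n) (mixedSpace K))ᴴ)))
    (hOut : ∀ (n : ℕ) (K : Type) [Field K] [NumberField K] (c C τ : ℝ),
      ∃ (Ω : Set (GL (Fin n) (AdeleRing (𝓞 K) K))) (t : ℝ), 0 < t ∧
        Ω ⊆ (standardParabolicGL (AdeleRing (𝓞 K) K) (id : Fin n → Fin n) :
          Set (GL (Fin n) (AdeleRing (𝓞 K) K))) ∧
        Ω ⊆ Set.range (GLn.ofInfinite n K) ∧ IsCompact (closure Ω) ∧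
        ∀ H : Matrix (Fin n) (Fin n) (mixedSpace K),
          SiegelFamily.IsReduced c C τ n (SiegelFamily.placeFamily K H) →
            ∃ b ∈ GLn.toMixed n K ''
                (((posRealScalar n K).range : Set (GL (Fin n) (AdeleRing (𝓞 K) K))) * Ω *
                  siegelCone n K t),
              (b : Matrix (Fin n) (Fin n) (mixedSpace K)) *
                (b : Matrix (Fin n) (Fin n) (mixedSpace K))ᴴ = H) :
    ∀ (k : Type) [Field k] (n : ℕ) (K : Type) [Field K] [NumberField K]
      (U : Subgroup (FiniteAdelicGL n K)),
      IsOpen (U : Set (FiniteAdelicGL n K)) → IsCompact (U : Set (FiniteAdelicGL n K)) →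
      ∀ (A : Rep k (U.comap (globalEmbedding n K))), Module.Finite k A →
        ∀ q : ℕ, Module.Finite k (groupCohomology A q) := by
  intro k _ n K _ _ U hUo hUc A hA q
  classical
  haveI : Module.Finite k A := hA
  -- (0) the cone model: `E = M_n(K ⊗ ℝ)`, the cone `C₀`, the action `g • H = g H gᴴ`, `x₀ = 1`
  obtain ⟨htrans, hstab, hinv, hconv⟩ := stub_coneModel n K
  set C₀ : Set (Matrix (Fin n) (Fin n) (mixedSpace K)) :=
    {H | (∀ w, (H.map (mixedSpaceEvalReal K w)).PosDef) ∧
      ∀ w, (H.map (mixedSpaceEvalComplex K w)).PosDef} with hC₀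
  letI instGL : MulAction (GL (Fin n) (mixedSpace K)) ↥C₀ :=
    { smul := fun g x => ⟨(g : Matrix (Fin n) (Fin n) (mixedSpace K)) * x *
          (g : Matrix (Fin n) (Fin n) (mixedSpace K))ᴴ, hinv g x.1 x.2.1 x.2.2⟩
      one_smul := fun x => Subtype.ext (by
        change ((1 : GL (Fin n) (mixedSpace K)) : Matrix (Fin n) (Fin n) (mixedSpace K)) * x *
          ((1 : GL (Fin n) (mixedSpace K)) : Matrix (Fin n) (Fin n) (mixedSpace K))ᴴ = x
        rw [Units.val_one, Matrix.conjTranspose_one, Matrix.one_mul, Matrix.mul_one])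
      mul_smul := fun g h x =>
        Subtype.ext (assembly_act_mul g h (x : Matrix (Fin n) (Fin n) (mixedSpace K))) }
  have hsmul_coe : ∀ (g : GL (Fin n) (mixedSpace K)) (x : ↥C₀),
      ((g • x : ↥C₀) : Matrix (Fin n) (Fin n) (mixedSpace K)) =
        (g : Matrix (Fin n) (Fin n) (mixedSpace K)) * x *
          (g : Matrix (Fin n) (Fin n) (mixedSpace K))ᴴ :=
    fun _ _ => rfl
  have hcont : ∀ g : GL (Fin n) (mixedSpace K), Continuous fun x : ↥C₀ => g • x := fun g =>
    ((assembly_continuous_act g).comp continuous_subtype_val).subtype_mk _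
  haveI : ContractibleSpace ↥C₀ := hconv.contractibleSpace ⟨1, assembly_one_mem_cone n K⟩
  set x₀ : ↥C₀ := ⟨1, assembly_one_mem_cone n K⟩ with hx₀
  set θ : GL (Fin n) K →* GL (Fin n) (mixedSpace K) :=
    Matrix.GeneralLinearGroup.map (mixedEmbedding K) with hθ
  have hf_apply : ∀ γ, globalEmbedding n K γ =
      Matrix.GeneralLinearGroup.map (algebraMap K (FiniteAdeleRing (𝓞 K) K)) γ := fun γ => rfl
  -- (1) the constants: fundamental set, sandwich-in, hull, sandwich-out
  obtain ⟨Ω, t, ht, hΩB, hΩinf, hΩc, Q₀, hQ₀, hcov₀⟩ := stub_archFundamentalSet n K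
  obtain ⟨c, C, τ, hin⟩ := hIn n K Ω hΩB hΩinf hΩc t ht
  obtain ⟨c', C', τ', hhull⟩ := hHull (InfinitePlace K) n c C τ
  obtain ⟨Ω', t', ht', hΩ'B, hΩ'inf, hΩ'c, hout⟩ := hOut n K c' C' τ'
  -- (2) the prototype `V = conv R₀`
  set R₀ : Set (Matrix (Fin n) (Fin n) (mixedSpace K)) :=
    {H | SiegelFamily.IsReduced c C τ n (SiegelFamily.placeFamily K H)} with hR₀
  set V : Set (Matrix (Fin n) (Fin n) (mixedSpace K)) := convexHull ℝ R₀ with hV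
  -- (2a, b) `R₀ ⊆ C₀` (positivity of reduced families), `V ⊆ C₀` (convexity of the cone)
  have hR₀C₀ : R₀ ⊆ C₀ := fun H hH => hPos.2 n K c C τ H hH
  have hVC₀ : V ⊆ C₀ := convexHull_min hR₀C₀ hconv
  -- (2c) `V` lies in the `(c', C', τ')`-reduced matrices (the Hull Lemma)
  have hVR₁ : ∀ H ∈ V, SiegelFamily.IsReduced c' C' τ' n (SiegelFamily.placeFamily K H) := by
    intro H hH
    have h₁ : SiegelFamily.placeFamily K H ∈ SiegelFamily.placeFamilyₗ K n '' convexHull ℝ R₀ :=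
      ⟨H, hH, rfl⟩
    rw [LinearMap.image_convexHull] at h₁
    have h₂ : (SiegelFamily.placeFamilyₗ K n) '' R₀ ⊆
        {F | SiegelFamily.IsReduced c C τ n F} := by
      rintro _ ⟨y, hy, rfl⟩
      exact hy
    exact hhull (convexHull_mono h₂ h₁)
  -- (2d) `V` is relatively open in the matrices with Hermitian family of places
  obtain ⟨S, hS⟩ := assembly_exists_submodule_placeFamily_isHermitian n K
  obtain ⟨O, hO, hRO⟩ := hOpen (InfinitePlace K) n c C τ
  have hR₀S : R₀ = (S : Set (Matrix (Fin n) (Fin n) (mixedSpace K))) ∩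
      SiegelFamily.placeFamily K ⁻¹' O := by
    ext H
    change SiegelFamily.placeFamily K H ∈ {F | SiegelFamily.IsReduced c C τ n F} ↔ _
    rw [hRO, hS]
    exact Iff.rfl
  obtain ⟨O', hO', hVO'⟩ :=
    assembly_convexHull_inter_relOpen S (hO.preimage (SiegelFamily.continuous_placeFamily n))
  have hVeq : V = (S : Set (Matrix (Fin n) (Fin n) (mixedSpace K))) ∩ O' := by rw [hV, hR₀S, hVO']
  have hXS : ∀ x : ↥C₀, (x : Matrix (Fin n) (Fin n) (mixedSpace K)) ∈
      (S : Set (Matrix (Fin n) (Fin n) (mixedSpace K))) := fun x => by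
    rw [hS]
    exact assembly_placeFamily_isHermitian_of_cone n K x.2.1 x.2.2
  -- the trace `V'` of `V` on the cone is open
  set V' : Set ↥C₀ := {x | (x : Matrix (Fin n) (Fin n) (mixedSpace K)) ∈ V} with hV'
  have hV'mem : ∀ x : ↥C₀, x ∈ V' ↔ (x : Matrix (Fin n) (Fin n) (mixedSpace K)) ∈ V :=
    fun _ => Iff.rfl
  have hV'open : IsOpen V' := by
    have he : V' = Subtype.val ⁻¹' O' := by
      ext x
      rw [hV'mem, hVeq]
      exact ⟨fun h => h.2, fun h => ⟨hXS x, h⟩⟩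
    rw [he]
    exact hO'.preimage continuous_subtype_val
  -- (3) the Siegel set `𝔖♯ = {h : h hᴴ ∈ V}` and the cover data
  set Sg : Set (GL (Fin n) (mixedSpace K)) :=
    {h | (h : Matrix (Fin n) (Fin n) (mixedSpace K)) *
      (h : Matrix (Fin n) (Fin n) (mixedSpace K))ᴴ ∈ V} with hSg
  have hO := SiegelCover.exists_cover_data_of_fundamentalSet_of_siegelProperty
    (X := ↥C₀) θ (globalEmbedding n K) U hUo hUc Sg (Kinf n K) x₀
    (fun g hg => Subtype.ext (by rw [hsmul_coe, hx₀, Matrix.mul_one]; exact (hstab g).2 hg))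
    (fun h hh => (hstab h).1 (by
      have := congrArg Subtype.val hh
      rwa [hsmul_coe, hx₀, Matrix.mul_one] at this))
    (fun x => by
      obtain ⟨g, hg⟩ := htrans x.1 x.2.1 x.2.2
      exact ⟨g, Subtype.ext (by rw [hsmul_coe, hx₀, Matrix.mul_one]; exact hg)⟩)
    ⟨Q₀, hQ₀, fun g => by
      obtain ⟨γ, hγ, b, hb, k', hk', hgbk⟩ := hcov₀ g
      exact ⟨γ, (hf_apply γ).symm ▸ hγ, b, subset_convexHull ℝ R₀ (hin b hb), k', hk', hgbk⟩⟩
    (fun Q hQ => by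
      refine (stub_archSiegelProperty n K Ω' hΩ'B hΩ'inf hΩ'c t' ht' Q hQ).subset ?_
      rintro γ ⟨hγ, b, hb, b', hb', k', hk', hγb⟩
      obtain ⟨b₁, hb₁, hb₁b⟩ := hout _ (hVR₁ _ hb)
      obtain ⟨b₁', hb₁', hb₁b'⟩ := hout _ (hVR₁ _ hb')
      have hk₁ : b₁⁻¹ * b ∈ Kinf n K :=
        (hstab _).1 (assembly_mul_conjTranspose_eq_one_of_eq hb₁b.symm)
      have hk₁' : b₁'⁻¹ * b' ∈ Kinf n K :=
        (hstab _).1 (assembly_mul_conjTranspose_eq_one_of_eq hb₁b'.symm)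
      refine ⟨(hf_apply γ) ▸ hγ, b₁, hb₁, b₁', hb₁', b₁'⁻¹ * b' * k' * (b₁⁻¹ * b)⁻¹,
        mul_mem (mul_mem hk₁' hk') (inv_mem hk₁), ?_⟩
      rw [mul_inv_rev, inv_inv]
      calc θ γ * b₁ = θ γ * b * (b⁻¹ * b₁) := by rw [mul_assoc, mul_inv_cancel_left]
        _ = b' * k' * (b⁻¹ * b₁) := by rw [hγb]
        _ = b₁' * (b₁'⁻¹ * b' * k' * (b⁻¹ * b₁)) := by simp only [mul_assoc, mul_inv_cancel_left])
  obtain ⟨Q, hQc, hcovX, hfinX⟩ := hO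
  -- (4) the free `Γ_U`-set of indices `ι = {γ : γ_f ∈ U · Q}`; the action on the cone through `θ`
  let ι : Type := {γ : GL (Fin n) K // globalEmbedding n K γ ∈ (U : Set (FiniteAdelicGL n K)) * Q}
  letI instι : MulAction ↥(U.comap (globalEmbedding n K)) ι :=
    { smul := fun g i => ⟨g.1 * i.1, by
        obtain ⟨u, hu, q', hq', huq⟩ := Set.mem_mul.1 i.2
        refine Set.mem_mul.2 ⟨globalEmbedding n K g.1 * u, U.mul_mem g.2 hu, q', hq', ?_⟩
        rw [map_mul, ← huq, mul_assoc]⟩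
      one_smul := fun i => Subtype.ext (one_mul _)
      mul_smul := fun g g' i => Subtype.ext (mul_assoc _ _ _) }
  have coe_smul_index : ∀ (g : ↥(U.comap (globalEmbedding n K))) (i : ι),
      ((g • i : ι) : GL (Fin n) K) = g.1 * i.1 := fun _ _ => rfl
  letI instX : MulAction ↥(U.comap (globalEmbedding n K)) ↥C₀ :=
    MulAction.compHom ↥C₀ (θ.comp (U.comap (globalEmbedding n K)).subtype)
  have hΓsmul : ∀ (g : ↥(U.comap (globalEmbedding n K))) (x : ↥C₀), g • x = θ g.1 • x :=
    fun _ _ => rfl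
  -- the cover `W i = θ(i) • V` traced on the cone
  set W : ι → Set ↥C₀ := fun i => {x | (θ i.1)⁻¹ • x ∈ V'} with hW
  have hWmem : ∀ (i : ι) (x : ↥C₀), x ∈ W i ↔ (θ i.1)⁻¹ • x ∈ V' := fun _ _ => Iff.rfl
  -- (5) Brown's criterion in Čech form for the free equivariant good cover
  refine stub_moduleFinite_goodCover (X := ↥C₀) (G := ↥(U.comap (globalEmbedding n K))) (ι := ι)
    W ?_ ?_ ?_ ?_ ?_ ?_ A q
  · -- the cover sets are open in the cone
    intro i
    exact hV'open.preimage (hcont _)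
  · -- they cover the cone (fundamental set)
    intro x _
    obtain ⟨γ, hγ, b, hb, hx⟩ := hcovX x
    refine Set.mem_iUnion.2 ⟨⟨γ, hγ⟩, ?_⟩
    rw [hWmem]
    change (θ γ)⁻¹ • x ∈ V'
    rw [← hx, inv_smul_smul, hV'mem, hsmul_coe, hx₀, Matrix.mul_one]
    exact hb
  · -- non-empty finite intersections are contractible (convexity)
    intro p J hJ
    have hT : Convex ℝ {M : Matrix (Fin n) (Fin n) (mixedSpace K) | ∀ l,
        (((θ (J l).1)⁻¹ : GL (Fin n) (mixedSpace K)) : Matrix (Fin n) (Fin n) (mixedSpace K)) * M *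
          (((θ (J l).1)⁻¹ : GL (Fin n) (mixedSpace K)) :
            Matrix (Fin n) (Fin n) (mixedSpace K))ᴴ ∈ V} := by
      rw [Set.setOf_forall]
      exact convex_iInter fun l =>
        (convex_convexHull ℝ R₀).is_linear_preimage (assembly_isLinearMap_act (θ (J l).1)⁻¹)
    have hce : cechSet W J = {x : ↥C₀ | (x : Matrix (Fin n) (Fin n) (mixedSpace K)) ∈
        {M : Matrix (Fin n) (Fin n) (mixedSpace K) | ∀ l,
          (((θ (J l).1)⁻¹ : GL (Fin n) (mixedSpace K)) : Matrix (Fin n) (Fin n) (mixedSpace K)) *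
            M * (((θ (J l).1)⁻¹ : GL (Fin n) (mixedSpace K)) :
              Matrix (Fin n) (Fin n) (mixedSpace K))ᴴ ∈ V}} := by
      ext x
      rw [mem_cechSet_iff]
      exact Iff.rfl
    rw [hce] at hJ ⊢
    obtain ⟨x, hx⟩ := hJ
    exact assembly_contractibleSpace_subtype_inter hconv hT ⟨x, hx⟩
  · -- equivariance `g • W i = W (g • i)`
    intro g i
    ext x
    constructor
    · rintro ⟨y, hy, rfl⟩
      change g • y ∈ W (g • i)
      rw [hWmem] at hy ⊢
      rw [coe_smul_index, map_mul, hΓsmul, mul_inv_rev, mul_smul, inv_smul_smul]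
      exact hy
    · intro hx
      rw [hWmem, coe_smul_index, map_mul, mul_inv_rev, mul_smul] at hx
      refine ⟨g⁻¹ • x, ?_, smul_inv_smul g x⟩
      rw [hWmem, hΓsmul, Subgroup.coe_inv, map_inv]
      exact hx
  · -- the action on indices is free
    intro g i hgi
    have h := congrArg Subtype.val hgi
    rw [coe_smul_index] at h
    exact Subtype.ext (mul_eq_right.1 h |>.symm ▸ rfl)
  · -- finitely many orbits of nerve simplices (Siegel property)
    intro p
    obtain ⟨S₀, hS₀, hrep⟩ := hfinX p
    refine ⟨{J₀ : Fin (p + 1) → ι | (fun l => (J₀ l).1) ∈ S₀}, ?_, ?_⟩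
    · refine hS₀.preimage ?_
      intro J₁ _ J₂ _ hJ
      funext l
      exact Subtype.ext (congrFun hJ l)
    · intro J hJ
      obtain ⟨x, hx⟩ := hJ
      rw [mem_cechSet_iff] at hx
      have hx' : ∃ x : ↥C₀, ∀ l, ∃ b ∈ Sg, θ (J l).1 • b • x₀ = x := by
        refine ⟨x, fun l => ?_⟩
        have hl := hx l
        rw [hWmem, hV'mem] at hl
        -- the point `θ(J l)⁻¹ • x` of `V ⊆ C₀` is `b bᴴ = b • x₀` (transitivity), and `b ∈ 𝔖♯`
        obtain ⟨b, hb⟩ := htrans _ (hVC₀ hl).1 (hVC₀ hl).2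
        have hy : b • x₀ = (θ (J l).1)⁻¹ • x :=
          Subtype.ext (by rw [hsmul_coe, hx₀, Matrix.mul_one]; exact hb)
        refine ⟨b, ?_, by rw [hy, smul_inv_smul]⟩
        change (b : Matrix (Fin n) (Fin n) (mixedSpace K)) *
          (b : Matrix (Fin n) (Fin n) (mixedSpace K))ᴴ ∈ V
        rw [hb]
        exact hl
      obtain ⟨J₀, hJ₀, g, hg, hgJ⟩ := hrep (fun l => (J l).1) (fun l => (J l).2) hx'
      have hmem : ∀ l, globalEmbedding n K (J₀ l) ∈ (U : Set (FiniteAdelicGL n K)) * Q := by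
        intro l
        obtain ⟨u, hu, q', hq', huq⟩ := Set.mem_mul.1 (J l).2
        refine Set.mem_mul.2 ⟨(globalEmbedding n K g)⁻¹ * u, U.mul_mem (U.inv_mem hg) hu,
          q', hq', ?_⟩
        have hk : J₀ l = g⁻¹ * (J l).1 := by rw [← hgJ l, inv_mul_cancel_left]
        rw [hk, map_mul, map_inv, mul_assoc, huq]
      refine ⟨fun l => ⟨J₀ l, hmem l⟩, hJ₀, ⟨g, hg⟩, ?_⟩
      funext l
      exact Subtype.ext (hgJ l)

end Summit.Langlands.Langlands.Theorems.HeckeEigenvalueField.Res
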